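import Literature.AnabelianGeometry.EtaleTheta.FrobenioidThetaOfThetaEnvData
import Literature.AnabelianGeometry.EtaleTheta.Discharge.Sec5EnvAut
import Mathlib.Algebra.Field.ZMod

/-!
# [EtTh] §5: a degenerate §5 datum — the data record is inhabited; the universal closures of two §5 schemata are refuted (pp. 330–335 / PDF pp. 104–109)

Mochizuki, *The étale theta function and its Frobenioid-theoretic manifestations*, Publ. RIMS **45**
(2009) [cite: MochizukiEtTh2009, §5 p.330 (PDF p.104)].  abc-iut cell, block F (fact-proving wave), seat
abc-iut-f-115; PROOF-ONLY companion of abc-iut-L2-t4's `FrobenioidTheta.lean` (the §5 data record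
`ThetaFrobenioid C D`), abc-iut-L2-t2's `MonoThetaEnv.lean` (`ThetaEnvData N`), abc-iut-L2-t4's constructor
`ThetaFrobenioid.ofThetaEnvData` (`FrobenioidThetaOfThetaEnvData.lean`), abc-iut-L2-d4's `Discharge/Sec5EnvAut.lean`
(`StabilizesEPiN`, FACT-LIST F-0517) and abc-iut-L2-t11's `Discharge/Sec5EnvelopeTopology.lean` (`IdentifiesPiYdd`,
FACT-LIST F-0519).  Nothing landed is edited or restated.

WHAT IS BUILT (namespace `Sec5Toy`, in the style of `TemperedFrobenioidToy.lean` / `Discharge/Sec3Cor38CriterionToy.lean`):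
ONE explicit, closed-term, degenerate inhabitant of the §5 data record over the one-object base category
`Discrete PUnit`: the tempered-Frobenioid stub with trivial divisor monoids / units / birational units `(ℤ/2)^×`,
the trivial subquotient stub, and a §2 datum `ThetaEnvData 1` with `Π^tp_X := ℤ × ℤ × ℤ` (discrete),
`Π^tp_X ↠ Gal(Y/X) ≅ ℤ` the FIRST projection (so `Π^tp_Y = 0 × ℤ × ℤ`), `Π^tp_Ÿ := 0 × ℤ × 2ℤ` (index `2` in `Π^tp_Y`),
`μ_1 = 1`, trivial cyclotomic character and the trivial theta class; assembled by `ThetaFrobenioid.ofThetaEnvData`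
(`l = N = 1`, `A_⊚ = A_N = B_N = pt`, `s^⊓_N = s^⊔_N = id`, `ρ, s^trv, s^⊓-gp, s^⊔-gp` trivial, `K = ℤ/2`).
CONSEQUENCES (kernel events for the cell's FROZEN FACT-LIST, plan R5 "a universal closure of a schema row is not a
fact"):
* `Sec5Toy.datum` / `nonempty_thetaFrobenioid` — the ≈ 60-field record `ThetaFrobenioid` is CONSISTENT (jointly
  satisfiable), so no §5 discharge is vacuously true for want of data;
* `Sec5Toy.facts_datum` — abc-iut-L2-t4's bundle `ThetaFrobenioid.Facts` (the printed §5 inputs `SgpCapSpec`, …,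
  `ConstantsActByCyclotome`, `Epi s^⊓_N`) holds at the degenerate datum: the HYPOTHESIS BUNDLE of the §5 discharges is
  consistent too;
* `not_stabilizesEPiN_datum`, **`not_forall_stabilizesEPiN`** (F-0517): the automorphism `ψ` of `Π^tp_X̲` swapping the
  first two factors (with `Φ = id`) does NOT stabilise `E^Π_N` — the universal closure of the schema
  `ThetaFrobenioid.StabilizesEPiN 𝔉 Φ ψ` over (§5 data at the one-object base, `Φ`, `ψ`) is FALSE; its instance form is
  abc-iut-L2-d4's `IsEnvCompatible.stabilizesEPiN` (compatible pairs, Thm. 5.10 (iii) p.335 (PDF p.109)), unchanged;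
* `not_identifiesPiYdd_datum`, **`not_forall_identifiesPiYdd`** (F-0519): the same swap, as an identification
  `ι : Π^tp_X̲ ≃ T.PiX`, does NOT carry `Π^tp_Ÿ̲` onto `Π^tp_Ÿ` — the universal closure of
  `ThetaFrobenioid.IdentifiesPiYdd 𝔉 T ι` is FALSE; its instance form is abc-iut-L2-t4's
  `identifiesPiYdd_ofThetaEnvData` (`ι = id` for §5 data built over `T`), unchanged.
HONEST FRAMING: a consistency witness and two counterexamples to ∀-closures of typed PREDICATES; the degenerate datum is
NOT the tempered Frobenioid of a curve and says nothing about [EtTh]'s theorems, which concern the genuine data; no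
FACT-LIST row is thereby proved; typed ≠ proved; nothing here bears on [IUTchIII] Cor. 3.12 and no side is taken on any
disputed claim.
-/

noncomputable section

namespace Literature.AnabelianGeometry.EtaleTheta

open CategoryTheory Literature.AlgebraicGeometry.Frobenioids

namespace Sec5Toy

/-! ### The one-object base and the trivial tempered-Frobenioid / subquotient stubs -/

/-- The one object of the base category `Discrete PUnit` (playing `A_⊚ = A_N = B_N` and their base objects).
[cite: MochizukiEtTh2009, §5 p.330 (PDF p.104)] -/
abbrev pt : Discrete PUnit.{1} := ⟨PUnit.unit⟩

/-- In the one-object discrete category every automorphism group is trivial.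
[cite: MochizukiEtTh2009, §5 p.330 (PDF p.104)] -/
theorem subsingleton_aut (X : Discrete PUnit.{1}) : Subsingleton (Aut X) :=
  ⟨fun _ _ => Iso.ext (Subsingleton.elim _ _)⟩

/-- The trivial pre-Frobenioid data on `Discrete PUnit → Discrete PUnit`: base functor the identity, all divisor
monoids trivial, all divisors zero, all Frobenius degrees `1` ([FrdI] Def. 1.1 (iv) shape only).
[cite: MochizukiEtTh2009, §5 p.322 (PDF p.96)] -/
def pre : PreFrobenioidData.{0} (Discrete PUnit.{1}) (Discrete PUnit.{1}) where
  base := 𝟭 _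
  Mon _ := PUnit
  pull _ := MonoidHom.id PUnit
  pull_id _ _ := rfl
  pull_comp _ _ _ := rfl
  div _ := PUnit.unit
  degFr _ := 1
  div_id _ := rfl
  div_comp _ _ := rfl
  degFr_id _ := rfl
  degFr_comp _ _ := (mul_one _).symm

/-- The trivial tempered-Frobenioid stub over `pre`: `O^×(S)` (trivial, hence abelian), birational units
`O^×(S^birat) := (ℤ/2)^×` (trivial group), trivial unit pull-backs, every morphism "of base-Frobenius type".
[cite: MochizukiEtTh2009, §5 p.322 (PDF p.96)] -/
def stub : FrobenioidTheta.TemperedFrobenioidStub.{0} (Discrete PUnit.{1}) (Discrete PUnit.{1}) where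
  pre := pre
  units_comm S := by
    haveI := subsingleton_aut S
    exact ⟨⟨fun _ _ => Subsingleton.elim _ _⟩⟩
  biratUnits _ := (ZMod 2)ˣ
  unitsToBirat _ := 1
  unitsToBirat_injective S := by
    haveI := subsingleton_aut S
    exact fun a b _ => Subsingleton.elim a b
  unitsPull _ := 1
  IsBaseFrobeniusType := ⊤

/-- The trivial subquotient stub `(l·Δ_Θ)_E := 1`. [cite: MochizukiEtTh2009, §5 p.327 (PDF p.101)] -/
def subquot : FrobenioidTheta.ThetaSubquotientStub.{0} (Discrete PUnit.{1}) where
  lDelta _ := PUnit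
  lDeltaMap _ := MonoidHom.id PUnit

/-! ### The §2 datum: `Π^tp_X := ℤ × ℤ × ℤ`, `Π^tp_Y := 0 × ℤ × ℤ`, `Π^tp_Ÿ := 0 × ℤ × 2ℤ`, `μ_1 := 1` -/

/-- `Π^tp_X := ℤ × (ℤ × ℤ)`, written multiplicatively, with the discrete topology of `ℤ`.
[cite: MochizukiEtTh2009, Def 2.13 p.273 (PDF p.47)] -/
abbrev Pi : Type := Multiplicative ℤ × (Multiplicative ℤ × Multiplicative ℤ)

/-- `Π^tp_X ↠ Gal(Y/X) ≅ ℤ`: the first projection. [cite: MochizukiEtTh2009, Def 2.13 (i) p.273 (PDF p.47)] -/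
def zq : Pi →* Multiplicative ℤ := MonoidHom.fst _ _

/-- The parity of the third coordinate, `Π^tp_X → ℤ/2` (cutting out `Π^tp_Ÿ` inside `Π^tp_Y`).
[cite: MochizukiEtTh2009, §2 p.267 (PDF p.41)] -/
def par : Pi →* Multiplicative (ZMod 2) :=
  (AddMonoidHom.toMultiplicative (Int.castAddHom (ZMod 2))).comp
    ((MonoidHom.snd _ _).comp (MonoidHom.snd (Multiplicative ℤ) _))

/-- `par` on elements. [cite: MochizukiEtTh2009, §2 p.267 (PDF p.41)] -/
@[simp] theorem par_apply (x : Pi) :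
    par x = Multiplicative.ofAdd (((Multiplicative.toAdd x.2.2 : ℤ)) : ZMod 2) := rfl

/-- `zq` on elements. [cite: MochizukiEtTh2009, Def 2.13 (i) p.273 (PDF p.47)] -/
@[simp] theorem zq_apply (x : Pi) : zq x = x.1 := rfl

/-- `zq` is onto. [cite: MochizukiEtTh2009, Def 2.13 (i) p.273 (PDF p.47)] -/
theorem zq_surjective : Function.Surjective zq := fun a => ⟨(a, 1), rfl⟩

/-- The element `(0, 0, 1)` of `Π^tp_Y ∖ Π^tp_Ÿ`. [cite: MochizukiEtTh2009, §2 p.267 (PDF p.41)] -/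
def a₀ : Pi := (1, (1, Multiplicative.ofAdd 1))

/-- The element `(0, 1, 0)` of `Π^tp_Ÿ` that the swap moves out of `Π^tp_Y`.
[cite: MochizukiEtTh2009, §2 p.267 (PDF p.41)] -/
def y₀ : Pi := (1, (Multiplicative.ofAdd 1, 1))

/-- `a₀ ∈ Π^tp_Y`. [cite: MochizukiEtTh2009, §2 p.267 (PDF p.41)] -/
theorem zq_a₀ : zq a₀ = 1 := rfl

/-- `a₀ ∈ Π^tp_Y`. [cite: MochizukiEtTh2009, §2 p.267 (PDF p.41)] -/
theorem a₀_mem : a₀ ∈ zq.ker := zq_a₀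

/-- `par a₀` is the non-trivial element of `ℤ/2`. [cite: MochizukiEtTh2009, §2 p.267 (PDF p.41)] -/
theorem par_a₀ : par a₀ = Multiplicative.ofAdd 1 := by
  simp [a₀]

/-- `y₀ ∈ Π^tp_Ÿ`. [cite: MochizukiEtTh2009, §2 p.267 (PDF p.41)] -/
theorem y₀_mem : y₀ ∈ zq.ker ⊓ par.ker := by
  refine ⟨rfl, ?_⟩
  simp [y₀]

/-- In `ℤ/2` (multiplicative notation): `x · 1̄ = 0̄` exactly when `x ≠ 0̄`. [folklore] -/
private theorem xor_mul_ofAdd_one (x : Multiplicative (ZMod 2)) :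
    Xor (x * Multiplicative.ofAdd 1 = 1) (x = 1) := by
  obtain ⟨t, rfl⟩ := Multiplicative.ofAdd.surjective x
  rw [← ofAdd_add, ofAdd_eq_one, ofAdd_eq_one]
  have ht : t = 0 ∨ t = 1 := by revert t; decide
  rcases ht with rfl | rfl
  · exact Or.inr ⟨rfl, by decide⟩
  · exact Or.inl ⟨by decide, by decide⟩

/-- `[Π^tp_Y : Π^tp_Ÿ] = 2`. [cite: MochizukiEtTh2009, §2 p.267 (PDF p.41)] -/
theorem index_PiYdd : ((zq.ker ⊓ par.ker).subgroupOf zq.ker).index = 2 := by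
  rw [Subgroup.index_eq_two_iff]
  refine ⟨⟨a₀, a₀_mem⟩, fun b => ?_⟩
  have hb : zq b = 1 := b.2
  simp only [Subgroup.mem_subgroupOf, Subgroup.coe_mul, Subgroup.mem_inf, MonoidHom.mem_ker, map_mul, hb,
    zq_a₀, par_a₀, mul_one, true_and]
  exact xor_mul_ofAdd_one _

/-- The swap of the first two factors of `Π^tp_X = ℤ × ℤ × ℤ`, a group automorphism.
[cite: MochizukiEtTh2009, Thm 5.10 (iii) p.335 (PDF p.109)] -/
def swap : Pi ≃* Pi where
  toFun x := (x.2.1, (x.1, x.2.2))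
  invFun x := (x.2.1, (x.1, x.2.2))
  left_inv _ := rfl
  right_inv _ := rfl
  map_mul' _ _ := rfl

/-- `swap y₀ = (1, 0, 0) ∉ Π^tp_Y`. [cite: MochizukiEtTh2009, Thm 5.10 (iii) p.335 (PDF p.109)] -/
theorem swap_y₀_not_mem : swap y₀ ∉ zq.ker := by
  simp [MonoidHom.mem_ker, swap, y₀]

/-- **The degenerate §2 datum `ThetaEnvData 1`**: `Π^tp_X := ℤ × ℤ × ℤ` (discrete), `G_K := Π^tp_X`, `Π^tp_Y := Ker(pr₁)`
with `Π^tp_X/Π^tp_Y ≅ ℤ`, `Π^tp_Ÿ := Ker(pr₁) ∩ Ker(parity of pr₃)` of index `2` in `Π^tp_Y`, `μ_1 := 1` with the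
trivial character, and the full (one-element) class of `1`-valued cocycles.
[cite: MochizukiEtTh2009, Def 2.13 p.273 (PDF p.47)] -/
def thetaEnvData : ThetaEnvData.{0} 1 where
  PiX := Pi
  G := Pi
  aug := MonoidHom.id Pi
  aug_surjective := Function.surjective_id
  PiY := zq.ker
  PiY_normal := inferInstance
  PiY_open := isOpen_discrete _
  galYX := QuotientGroup.quotientKerEquivOfSurjective zq zq_surjective
  PiYdd := zq.ker ⊓ par.ker
  PiYdd_le := inf_le_left
  PiYdd_normal := inferInstance
  PiYdd_open := isOpen_discrete _
  index_PiYdd := index_PiYdd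
  mu := PUnit
  topMu := ⊥
  discMu := ⟨rfl⟩
  finMu := inferInstance
  mu_cyclic := ⟨⟨1, fun _ => ⟨0, Subsingleton.elim _ _⟩⟩⟩
  card_mu := by simp
  chi := 1
  chi_ker_open := isOpen_discrete _
  thetaCocycles := Set.univ
  thetaCocycles_nonempty := Set.univ_nonempty
  isCocycle _ _ _ _ := rfl
  locallyConstant η _ := IsLocallyConstant.of_discrete η
  mul_coboundary_mem _ _ _ := Set.mem_univ _

/-- `Π^tp_X` of the §2 datum is discrete. [cite: MochizukiEtTh2009, Lem 5.9 (iv) p.332 (PDF p.106)] -/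
theorem discreteTopology_PiX : DiscreteTopology thetaEnvData.PiX := by
  change DiscreteTopology Pi
  infer_instance

/-! ### The degenerate §5 datum -/

/-- `id : pt → pt` is a pre-step of the trivial data (linear base-isomorphism).
[cite: MochizukiEtTh2009, §5 p.330 (PDF p.104)] -/
theorem isPreStep_id : stub.pre.IsPreStep (𝟙 pt) :=
  ⟨rfl, (inferInstance : IsIso (𝟙 pt))⟩

/-- The trivial `ρ : Π^tp_X → Aut_D(B_N^bs)` is onto (the target is trivial).
[cite: MochizukiEtTh2009, Def 4.1 (ii) p.313 (PDF p.87)] -/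
theorem one_surjective : Function.Surjective (1 : Pi →* Aut (stub.pre.base.obj pt)) := by
  haveI := subsingleton_aut (stub.pre.base.obj pt)
  exact fun a => ⟨1, Subsingleton.elim _ _⟩

/-- **The degenerate §5 datum** `ThetaFrobenioid (Discrete PUnit) (Discrete PUnit)`: abc-iut-L2-t4's
`ThetaFrobenioid.ofThetaEnvData` fed with the trivial stubs, `l = N = 1`, `A_⊚ = A_N = B_N = pt`, `s^⊓_N = s^⊔_N = id`,
trivial `ρ, s^trv_N, s^⊓-gp_N, s^⊔-gp_N`, `K := ℤ/2` with `K^× ↪ O^×(B_N^birat)` the identity, `Θ̈ := 1`, over the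
§2 datum `thetaEnvData`.  [cite: MochizukiEtTh2009, §5 p.330–332 (PDF pp.104–106)] -/
def datum : ThetaFrobenioid.{0} (Discrete PUnit.{1}) (Discrete PUnit.{1}) :=
  ThetaFrobenioid.ofThetaEnvData stub subquot 1 odd_one 1 thetaEnvData pt pt pt (𝟙 pt) (𝟙 pt) rfl
    isPreStep_id isPreStep_id 1 one_surjective (haveI := discreteTopology_PiX; isOpen_discrete _) 1 1 1
    (ZMod 2) (MonoidHom.id _) Function.injective_id 1

/-- **The §5 data record is inhabited.** [cite: MochizukiEtTh2009, §5 p.330 (PDF p.104)] -/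
theorem nonempty_thetaFrobenioid : Nonempty (ThetaFrobenioid.{0} (Discrete PUnit.{1}) (Discrete PUnit.{1})) :=
  ⟨datum⟩

/-- `Π^tp_X̲` of the datum is `ℤ × ℤ × ℤ`. [cite: MochizukiEtTh2009, §5 p.330 (PDF p.104)] -/
theorem datum_PiX : datum.PiX = Pi := rfl

/-- `Π^tp_Y̲` of the datum is `Ker(pr₁)`. [cite: MochizukiEtTh2009, Lem 5.9 (iii) p.332 (PDF p.106)] -/
theorem datum_PiY : datum.PiY = zq.ker := thetaEnvData.ker_zquot

/-- `Π^tp_Ÿ̲` of the datum is `Ker(pr₁) ∩ Ker(parity of pr₃)`. [cite: MochizukiEtTh2009, Lem 5.9 (iv) p.332 (PDF p.106)] -/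
theorem datum_PiYdd : datum.PiYdd = zq.ker ⊓ par.ker := rfl

/-- `Aut_C(B_N)` of the datum is trivial. [cite: MochizukiEtTh2009, §5 p.330 (PDF p.104)] -/
theorem subsingleton_aut_BN : Subsingleton (Aut datum.BN) := subsingleton_aut _

/-- `Aut_D(B_N^bs)` of the datum is trivial. [cite: MochizukiEtTh2009, §5 p.330 (PDF p.104)] -/
theorem subsingleton_aut_base_BN : Subsingleton (Aut (datum.base.obj datum.BN)) := subsingleton_aut _

/-- `Π^tp_X̲` of the datum is discrete. [cite: MochizukiEtTh2009, Lem 5.9 (iv) p.332 (PDF p.106)] -/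
theorem discreteTopology_datum_PiX : DiscreteTopology datum.PiX := discreteTopology_PiX

/-! ### The hypothesis bundle `Facts` holds at the degenerate datum -/

/-- abc-iut-L2-t4's bundle `Facts` of printed §5 inputs (`SgpCapSpec`, `SgpCupSpec`, `StrvSection`,
`BiKummerDifferenceMem`, `AutAmpleBN`, `ConstantsActByCyclotome`, `Epi s^⊓_N`, `Epi s^⊔_N`) holds at the degenerate
datum — every clause is an identity between morphisms of the one-object category or between elements of a trivial
group.  [cite: MochizukiEtTh2009, §5 pp.330–331 (PDF pp.104–105)] -/
theorem facts_datum : datum.Facts := by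
  haveI := subsingleton_aut_BN
  haveI := subsingleton_aut_base_BN
  haveI : Subsingleton (Aut (datum.base.obj datum.AN)) := subsingleton_aut _
  refine ⟨fun _ => Subsingleton.elim _ _, fun _ => Subsingleton.elim _ _, fun _ => Subsingleton.elim _ _,
    fun _ => ?_, fun a => ⟨1, Subsingleton.elim _ _⟩, fun u => ?_, ?_, ?_⟩
  · rw [Subsingleton.elim (_ * _ : Aut datum.BN) 1]
    exact Subgroup.one_mem _
  · obtain rfl : u = 1 := Subsingleton.elim _ _
    refine ⟨fun _ => ⟨Subgroup.one_mem _, fun y _ => ?_⟩, fun _ => Subgroup.one_mem _⟩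
    rw [Subsingleton.elim (_ * _ : Aut datum.BN) 1]
    exact Subgroup.one_mem _
  · exact (inferInstance : Epi (𝟙 pt))
  · exact (inferInstance : Epi (𝟙 pt))

/-! ### F-0517: the universal closure of `StabilizesEPiN` is false -/

/-- The swap of the first two factors of `Π^tp_X̲ = ℤ × ℤ × ℤ` as an automorphism of the (discrete) topological group
`Π^tp_X̲` of the datum.  [cite: MochizukiEtTh2009, Thm 5.10 (iii) p.335 (PDF p.109)] -/
def swapTop : datum.PiX ≃ₜ* datum.PiX :=
  haveI := discreteTopology_datum_PiX
  { (swap : datum.PiX ≃* datum.PiX) with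
    continuous_toFun := continuous_of_discreteTopology
    continuous_invFun := continuous_of_discreteTopology }

/-- `swapTop` is `swap` on elements. [cite: MochizukiEtTh2009, Thm 5.10 (iii) p.335 (PDF p.109)] -/
@[simp] theorem swapTop_apply (x : datum.PiX) : swapTop x = swap x := rfl

/-- `(1, y₀) ∈ E^Π_N` for the datum. [cite: MochizukiEtTh2009, Lem 5.9 (iv) p.332 (PDF p.106)] -/
theorem one_y₀_mem_EPiN : ((1 : Aut datum.BN), (y₀ : datum.PiX)) ∈ datum.EPiN := by
  haveI := subsingleton_aut_base_BN
  refine ⟨Subgroup.one_mem _, ?_, Subsingleton.elim _ _⟩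
  change y₀ ∈ datum.PiY
  rw [datum_PiY]
  exact y₀_mem.1

/-- **F-0517 at the degenerate datum**: the pair `(Φ, ψ) = (id, swap)` does NOT stabilise `E^Π_N` — `(1, (0,1,0))`
lies in `E^Π_N` but its image `(1, (1,0,0))` does not (its `Π`-coordinate leaves `Π^tp_Y̲ = Ker(pr₁)`).
[cite: MochizukiEtTh2009, Thm 5.10 (iii) p.335 (PDF p.109)] -/
theorem not_stabilizesEPiN_datum : ¬ datum.StabilizesEPiN (MulEquiv.refl _) swapTop := by
  intro h
  have h' := (h ((1 : Aut datum.BN), (y₀ : datum.PiX))).mp one_y₀_mem_EPiN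
  rw [ThetaFrobenioid.ambientAut_apply, ThetaFrobenioid.mem_EPiN] at h'
  have hy : swap y₀ ∈ datum.PiY := h'.2.1
  rw [datum_PiY] at hy
  exact swap_y₀_not_mem hy

/-- **F-0517: the universal closure of the schema `StabilizesEPiN` is FALSE** (already over §5 data at the one-object
base category): "`(Φ, ψ)` stabilises `E^Π_N`" is a HYPOTHESIS on the pair — print derives it for the compatible pairs
of Thm. 5.10 (iii) (abc-iut-L2-d4's `IsEnvCompatible.stabilizesEPiN`), not for arbitrary ones.  FACT-LIST R5: named
instances only.  [cite: MochizukiEtTh2009, Thm 5.10 (iii) p.335 (PDF p.109)] -/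
theorem not_forall_stabilizesEPiN :
    ¬ ∀ (𝔉 : ThetaFrobenioid.{0} (Discrete PUnit.{1}) (Discrete PUnit.{1}))
        (Φ : Aut 𝔉.BN ≃* Aut 𝔉.BN) (ψ : 𝔉.PiX ≃ₜ* 𝔉.PiX), 𝔉.StabilizesEPiN Φ ψ :=
  fun h => not_stabilizesEPiN_datum (h datum _ _)

/-! ### F-0519: the universal closure of `IdentifiesPiYdd` is false -/

/-- **F-0519 at the degenerate datum**: the identification `ι := swap : Π^tp_X̲ ≃ T.PiX` (the datum IS built over
`T = thetaEnvData`, so both sides are `ℤ × ℤ × ℤ`) does NOT carry `Π^tp_Ÿ̲` onto `Π^tp_Ÿ`: `(0,1,0) ∈ Π^tp_Ÿ̲` goes to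
`(1,0,0) ∉ Π^tp_Y ⊇ Π^tp_Ÿ`.  [cite: MochizukiEtTh2009, Lem 5.9 (iv) p.332 (PDF p.106)] -/
theorem not_identifiesPiYdd_datum : ¬ datum.IdentifiesPiYdd thetaEnvData swap := by
  intro h
  have hy : swap y₀ ∈ zq.ker ⊓ par.ker := (h y₀).mp y₀_mem
  exact swap_y₀_not_mem hy.1

/-- **F-0519: the universal closure of the schema `IdentifiesPiYdd` is FALSE** (already over §5 data at the
one-object base category): "`ι` carries `Π^tp_Ÿ̲` onto `Π^tp_Ÿ`" is a HYPOTHESIS on the identification `ι` of the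
§5 and §2 interfaces — it holds for `ι = id` when the §5 data are built over the §2 data (abc-iut-L2-t4's
`identifiesPiYdd_ofThetaEnvData`), not for arbitrary `ι`.  FACT-LIST R5: named instances only.
[cite: MochizukiEtTh2009, Lem 5.9 (iv) p.332 (PDF p.106)] -/
theorem not_forall_identifiesPiYdd :
    ¬ ∀ (𝔉 : ThetaFrobenioid.{0} (Discrete PUnit.{1}) (Discrete PUnit.{1}))
        (T : ThetaEnvData.{0} 𝔉.N) (ι : 𝔉.PiX ≃* T.PiX), 𝔉.IdentifiesPiYdd T ι :=
  fun h => not_identifiesPiYdd_datum (h datum thetaEnvData swap)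

/-- … while at the SAME datum the identity identification does carry `Π^tp_Ÿ̲` onto `Π^tp_Ÿ` (the instance form of
record, abc-iut-L2-t4's `identifiesPiYdd_ofThetaEnvData`, is not vacuous).  [cite: MochizukiEtTh2009, Lem 5.9 (iv) p.332 (PDF p.106)] -/
theorem identifiesPiYdd_datum_refl : datum.IdentifiesPiYdd thetaEnvData (MulEquiv.refl _) :=
  fun _ => Iff.rfl

end Sec5Toy

end Literature.AnabelianGeometry.EtaleTheta
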